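/- EXTRA WIDTH seat `ym-line-cbag-p1-w4` (prover-ym-line-cbag-p1-w4-g13-0), LINE 7b `VolumeComparison` of route `GlueballBandRecursion`,
item ⟨stmt-QuantumFields-22957⟩ (`--supports`, helper; it closes nothing).  THE SUPPORT EXPANSION OF THE TUBE FREE
ENERGY `log Z(b³×T)` (singletons + kept closed connected supports + rate-tracking tail, on the whole strong-coupling disc) and the two-volume
comparison of `log Z(a³×T)/a³` REDUCED to one identity — the per-site agreement of the kept (closed, connected, `≤ 4(a−1)` plaquettes) support
sums of the two spatial volumes (piece C3, lifting).  Def-free; sequel `…VolumeJetsOfLifting.lean` derives the LEAD's jet stubs. -/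
import Summits.QuantumFields.YangMills.Theorems.GlueballBandRecursionThermalFreeEnergyAnalytic
import Summits.QuantumFields.YangMills.Theorems.GlueballBandRecursionClosedSupportsBox

/-!
# Route `GlueballBandRecursion`, LINE 7b: the thermal free-energy jets from the support expansion, modulo lifting

Box system `S_{b,T} = boxSystem ρ ![b,b,b,T]` on `zdHaar 4 G`; `tubeLogZ ρ b T z = log Z(b³×T)(z)` is its Kotecký–Preiss logarithm over all
`6b³T` labels (`Thermal.tubeLogZ`).  With the support sums `ψ(A)(z) = Σ_{𝒞 ⊆ 𝒫(A), ⋃𝒞 = A} Φ^T(𝒞)` (`Support.pertLogZ_eq_sum_support`), the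
KEPT SUM at cutoff `k`,
`K_{b,T,k}(z) := Σ_{A ⊆ labels : closed ∧ S.Adj-connected ∧ #A ≤ k} ψ(A)(z)` (closed = no private bond; always written out), and the
one-plaquette logarithm `log c(z)`, `c(z) = ∫_G e^{−z(N − Re tr ρ h)} dh`:

* §1 `norm_tubeLogZ_sub_kept_le` — **the support expansion of the tube free energy**: for sides `b, T ≥ 2`, every cutoff `k` and `‖z‖ ≤ r_ρ`
  (`r_ρ = strongCouplingRadius ρ`): `‖log Z(b³×T)(z) − 6b³T·log c(z) − K_{b,T,k}(z)‖ ≤ 6b³T·(‖z‖/(e·r_ρ))^{k+1}`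
  (`Support.norm_pertLogZ_sub_sum_closed_support_le_rate` at the rate `τ = 1 + log(r_ρ/‖z‖)`, admissible up to `r_ρ` by module XII's
  `strongCouplingRadius_smallness`; singletons by `Support.sum_support_card_eq_one`; «large» = `#A ≥ k+1`, no slab lemma needed HERE).
* §2 `norm_tubeLogZ_div_sub_le_of_kept_eq` — two spatial volumes `2 ≤ a ≤ a'`, same period `T ≥ 2`, cutoff `k = 4(a−1)`: IF the kept sums agree
  per site, `K_{a',T,4(a−1)}(z)/a'³ = K_{a,T,4(a−1)}(z)/a³` (piece C3: closed connected supports with `≤ 4(a−1)` plaquettes are rooted at scale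
  `a−1` — w2's `SlabCount.exists_rooting_of_closed` — and lift between the boxes with equal `ψ`), THEN
  `‖log Z(a'³×T)/a'³ − log Z(a³×T)/a³‖ ≤ 12T·(‖z‖/(e r_ρ))^{4a−3}`.
* (sequel `…VolumeJetsOfLifting.lean`) the tube rates (`T → ∞`), `‖volumeDiscrepancy‖ ≤ 24t(‖z‖/(e r_ρ))^{4a−3}`,
  `‖coldVolumeDiscrepancy‖ ≤ 48t(…)^{4a−3}`, and both jet stubs of `ThermalFreeEnergyDefs` from the lifting identity.

HONEST FRAMING.  Bookkeeping for the ∃-window strong-coupling RECORD rung; the lifting identity (C3) is a HYPOTHESIS here; nothing proves item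
22957, the rung `ColdDoublingRecursionStrongCoupling`, or the Yang–Mills mass gap / the summit `YangMills`.
-/

set_option autoImplicit false

noncomputable section

open MeasureTheory Finset Filter Topology Asymptotics
open Literature.Probability.LatticeModels
open Literature.MathematicalPhysics.QuantumFieldTheory
open Literature.MathematicalPhysics.QuantumFieldTheory.Balaban1983to89.Missing
open Summit.QuantumFields.YangMills.Theorems.GlueballBandRecursion.Support

namespace Summit.QuantumFields.YangMills.Theorems.GlueballBandRecursion.Thermal

section PerBox

variable {G : Type*} [Group G] [TopologicalSpace G] [IsTopologicalGroup G] [CompactSpace G] [MeasurableSpace G] [BorelSpace G]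
  {N : ℕ} (ρ : G →* Matrix (Fin N) (Fin N) ℂ)

/-! ## §0 The thermal box `![b,b,b,T]` and the rate `τ = 1 + log(r_ρ/‖z‖)` -/

/-- All sides of `![b,b,b,T]` exceed `1` when `b, T ≥ 2`. -/
theorem one_lt_sides {b T : ℕ} (hb : 1 < b) (hT : 1 < T) : ∀ i : Fin 4, 1 < (![b, b, b, T] : Fin 4 → ℕ) i := by
  intro i
  fin_cases i <;> simp [hb, hT]

/-- The thermal box has `6 b³ T` labels. -/
theorem card_univ_boxLabel (b T : ℕ) :
    (Finset.univ : Finset (BoxLabel (![b, b, b, T] : Fin 4 → ℕ))).card = b * b * b * T * 6 := by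
  rw [Finset.card_univ, card_boxLabel_four]

/-- `tubeLogZ` is the Kotecký–Preiss logarithm of the box system over all labels. -/
theorem tubeLogZ_eq (b T : ℕ) (z : ℂ) :
    tubeLogZ ρ b T z = pertLogZ (zdHaar 4 G) ((boxSystem (G := G) ρ (![b, b, b, T] : Fin 4 → ℕ)).weight z)
      (boxSystem (G := G) ρ (![b, b, b, T] : Fin 4 → ℕ)).Adj Finset.univ := rfl

omit [TopologicalSpace G] [IsTopologicalGroup G] [CompactSpace G] [MeasurableSpace G] [BorelSpace G] in
/-- **The rate up to the radius.**  For `0 < ‖z‖ ≤ r_ρ` the rate `τ = 1 + log(r_ρ/‖z‖)` is `≥ 1`, satisfies module XII's smallness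
`e^{1+τ}(2M_ρ‖z‖)(boxDeg 4 + 1)² ≤ 1/2`, and `e^{−τm} = (‖z‖/(e·r_ρ))^m`. -/
theorem rate_of_norm_le {z : ℂ} (hz0 : z ≠ 0) (hz : ‖z‖ ≤ strongCouplingRadius ρ) :
    1 ≤ 1 + Real.log (strongCouplingRadius ρ / ‖z‖) ∧
      Real.exp (1 + (1 + Real.log (strongCouplingRadius ρ / ‖z‖))) * (2 * costBound ρ * ‖z‖) * ((boxDeg 4 : ℝ) + 1) ^ 2 ≤ 1 / 2 ∧
      ∀ m : ℕ, Real.exp (-((1 + Real.log (strongCouplingRadius ρ / ‖z‖)) * m)) =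
        (‖z‖ / (Real.exp 1 * strongCouplingRadius ρ)) ^ m := by
  have hr := strongCouplingRadius_pos ρ
  have hzpos : 0 < ‖z‖ := norm_pos_iff.2 hz0
  have hq : 1 ≤ strongCouplingRadius ρ / ‖z‖ := by rw [le_div_iff₀ hzpos, one_mul]; exact hz
  have hlog : 0 ≤ Real.log (strongCouplingRadius ρ / ‖z‖) := Real.log_nonneg hq
  refine ⟨by linarith, ?_, fun m => ?_⟩
  · have hexp : Real.exp (1 + (1 + Real.log (strongCouplingRadius ρ / ‖z‖))) =
        Real.exp 2 * (strongCouplingRadius ρ / ‖z‖) := by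
      rw [show (1 : ℝ) + (1 + Real.log (strongCouplingRadius ρ / ‖z‖)) = 2 + Real.log (strongCouplingRadius ρ / ‖z‖) by ring,
        Real.exp_add, Real.exp_log (lt_of_lt_of_le one_pos hq)]
    rw [hexp]
    have heq : Real.exp 2 * (strongCouplingRadius ρ / ‖z‖) * (2 * costBound ρ * ‖z‖) =
        Real.exp 2 * (2 * costBound ρ * strongCouplingRadius ρ) := by
      field_simp
    rw [heq]
    exact strongCouplingRadius_smallness ρ
  · rw [show -((1 + Real.log (strongCouplingRadius ρ / ‖z‖)) * m) =
        (m : ℝ) * (-(1 + Real.log (strongCouplingRadius ρ / ‖z‖))) by ring, Real.exp_nat_mul]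
    congr 1
    rw [neg_add, Real.exp_add, Real.exp_neg (Real.log _), Real.exp_log (lt_of_lt_of_le one_pos hq), inv_div,
      Real.exp_neg]
    field_simp

/-- Splitting a filtered sum over a disjoint disjunction; the three decidability instances are ARBITRARY (implicit, filled by unification),
so that the lemma rewrites sums whose instances were synthesised elsewhere. -/
theorem sum_filter_or_eq_add {ι M : Type*} [AddCommMonoid M] {s : Finset ι} {p q : ι → Prop} {_ : DecidablePred p}
    {_ : DecidablePred q} {_ : DecidablePred fun a => p a ∨ q a} {f : ι → M} (h : ∀ a ∈ s, p a → ¬ q a) :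
    ∑ a ∈ s with (p a ∨ q a), f a = ∑ a ∈ s with p a, f a + ∑ a ∈ s with q a, f a := by
  rw [Finset.sum_filter, Finset.sum_filter, Finset.sum_filter, ← Finset.sum_add_distrib]
  refine Finset.sum_congr rfl fun a ha => ?_
  by_cases hp : p a
  · have hq : ¬ q a := h a ha hp
    rw [if_pos (Or.inl hp), if_pos hp, if_neg hq, add_zero]
  · by_cases hq : q a
    · rw [if_pos (Or.inr hq), if_neg hp, if_pos hq, zero_add]
    · rw [if_neg (by tauto), if_neg hp, if_neg hq, add_zero]

/-! ## §1 The support expansion of the tube free energy -/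

open scoped Classical in
/-- **The support expansion of `log Z(b³×T)`.**  For sides `b, T ≥ 2`, every cutoff `k` and every `‖z‖ ≤ r_ρ`:
`‖tubeLogZ ρ b T z − 6b³T · log c(z) − K_{b,T,k}(z)‖ ≤ 6b³T · (‖z‖/(e r_ρ))^{k+1}`, where `K_{b,T,k}` is the sum of the support sums `ψ(A)`
over the CLOSED, connected label families with `#A ≤ k`, and `c(z) = ∫_G e^{−z(N − Re tr ρ h)} dh`.  (Non-closed families drop out
identically; the others of size `> k` are inside the rate-tracking tail at `τ = 1 + log(r_ρ/‖z‖)`.) -/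
theorem norm_tubeLogZ_sub_kept_le (hρ : Continuous ρ) {b T : ℕ} (hb : 1 < b) (hT : 1 < T) (k : ℕ) {z : ℂ}
    (hz : ‖z‖ ≤ strongCouplingRadius ρ) :
    ‖tubeLogZ ρ b T z - ((b * b * b * T * 6 : ℕ) : ℂ) *
          Complex.log (∫ h, Complex.exp (-(z * (((N : ℝ) - (ρ h).trace.re : ℝ) : ℂ))) ∂haarProbability G) -
        ∑ A ∈ (Finset.univ : Finset (BoxLabel (![b, b, b, T] : Fin 4 → ℕ))).powerset with
            ((∀ p ∈ A, ∀ e ∈ p.bonds, ∃ q ∈ A, q ≠ p ∧ e ∈ q.bonds) ∧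
              IsRConnected (boxSystem (G := G) ρ (![b, b, b, T] : Fin 4 → ℕ)).Adj A ∧ A.card ≤ k),
          ∑ 𝒞 ∈ (rconnSubsets (boxSystem (G := G) ρ (![b, b, b, T] : Fin 4 → ℕ)).Adj A).powerset with 𝒞.biUnion id = A,
            truncatedWeight (GeomInc (boxSystem (G := G) ρ (![b, b, b, T] : Fin 4 → ℕ)).Adj)
              (connActivity (boxSystem (G := G) ρ (![b, b, b, T] : Fin 4 → ℕ)).Adj (zdHaar 4 G)
                ((boxSystem (G := G) ρ (![b, b, b, T] : Fin 4 → ℕ)).weight z)) 𝒞‖ ≤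
      (b * b * b * T * 6 : ℕ) * (‖z‖ / (Real.exp 1 * strongCouplingRadius ρ)) ^ (k + 1) := by
  set n4 : Fin 4 → ℕ := ![b, b, b, T] with hn4
  have hn : ∀ i, 1 < n4 i := one_lt_sides hb hT
  have hM := costBound_pos ρ
  have hr := strongCouplingRadius_pos ρ
  have hrM := strongCouplingRadius_mul_costBound_le_one ρ
  -- the e¹-disc hypothesis at radius `r_ρ` (weaker than module XII's e²-smallness)
  have hsmall1r : Real.exp 1 * (2 * costBound ρ * strongCouplingRadius ρ) * ((boxDeg 4 : ℝ) + 1) ^ 2 ≤ 1 / 2 := by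
    have h2 := strongCouplingRadius_smallness ρ
    have h1 : Real.exp 1 ≤ Real.exp 2 := Real.exp_le_exp.2 (by norm_num)
    have h0 : 0 ≤ 2 * costBound ρ * strongCouplingRadius ρ * ((boxDeg 4 : ℝ) + 1) ^ 2 := by positivity
    nlinarith
  rw [tubeLogZ_eq, ← hn4]
  by_cases hz0 : z = 0
  · -- at `z = 0` everything vanishes
    subst hz0
    have hψ0 : ∀ A : Finset (BoxLabel n4),
        ∑ 𝒞 ∈ (rconnSubsets (boxSystem (G := G) ρ n4).Adj A).powerset with 𝒞.biUnion id = A,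
          truncatedWeight (GeomInc (boxSystem (G := G) ρ n4).Adj)
            (connActivity (boxSystem (G := G) ρ n4).Adj (zdHaar 4 G) ((boxSystem (G := G) ρ n4).weight 0)) 𝒞 = 0 := by
      intro A
      rw [support_sum_eq_moebius]
      refine Finset.sum_eq_zero fun B _ => ?_
      rw [pertLogZ_weight_zero, mul_zero]
    have hlog0 : Complex.log (∫ h, Complex.exp (-((0 : ℂ) * (((N : ℝ) - (ρ h).trace.re : ℝ) : ℂ))) ∂haarProbability G) = 0 := by
      simp
    rw [pertLogZ_weight_zero, hlog0, Finset.sum_eq_zero (fun A _ => hψ0 A), mul_zero, sub_zero, sub_zero, norm_zero]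
    positivity
  obtain ⟨hτ1, hsmallτ, hexpτ⟩ := rate_of_norm_le ρ hz0 hz
  have hzM : ‖z‖ * costBound ρ ≤ 1 := le_trans (by gcongr) hrM
  -- the truncation by support with kept family `#A = 1 ∨ (closed ∧ connected ∧ #A ≤ k)`
  have htr := norm_pertLogZ_sub_sum_closed_support_le_rate (G := G) (n := n4) ρ hρ hn hzM (by linarith) hsmallτ Finset.univ
    (fun A => A.card ≤ k) (k + 1) (fun A _ _ _ hk => by omega)
  rw [hexpτ (k + 1), card_univ_boxLabel] at htr
  -- split off the singletons (a singleton is never closed: its first bond is private)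
  have hsing := sum_support_card_eq_one (G := G) (n := n4) ρ hρ hn hrM hsmall1r Finset.univ hz
  rw [card_univ_boxLabel] at hsing
  rw [sum_filter_or_eq_add ?_, hsing] at htr
  · rw [sub_sub]
    convert htr
  · intro A _ hA1 h
    obtain ⟨p, rfl⟩ := Finset.card_eq_one.1 hA1
    obtain ⟨q, hq, hqp, -⟩ := h.1 p (Finset.mem_singleton_self p) _ p.mem_bonds_self
    exact hqp (Finset.mem_singleton.1 hq)

end PerBox

/-! ## §2 Two spatial volumes: the tube free-energy densities, modulo the lifting identity -/

section TwoVolumes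

variable {G : Type*} [Group G] [TopologicalSpace G] [IsTopologicalGroup G] [CompactSpace G] [MeasurableSpace G] [BorelSpace G]
  {N : ℕ} (ρ : G →* Matrix (Fin N) (Fin N) ℂ)

open scoped Classical in
/-- **Volume comparison of the tube free-energy density, modulo lifting.**  Spatial sides `2 ≤ a ≤ a'`, common period `T ≥ 2`, `‖z‖ ≤ r_ρ`.
IF the kept sums at cutoff `4(a−1)` agree per site, `K_{a',T,4(a−1)}(z)/a'³ = K_{a,T,4(a−1)}(z)/a³` (piece C3 — the lifting of rooted closed
connected supports between the two boxes), THEN `‖tubeLogZ ρ a' T z/a'³ − tubeLogZ ρ a T z/a³‖ ≤ 12T·(‖z‖/(e r_ρ))^{4(a−1)+1}`. -/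
theorem norm_tubeLogZ_div_sub_le_of_kept_eq (hρ : Continuous ρ) {a a' T : ℕ} (ha : 1 < a) (haa' : a ≤ a') (hT : 1 < T) {z : ℂ}
    (hz : ‖z‖ ≤ strongCouplingRadius ρ)
    (hlift :
      (∑ A ∈ (Finset.univ : Finset (BoxLabel (![a', a', a', T] : Fin 4 → ℕ))).powerset with
            ((∀ p ∈ A, ∀ e ∈ p.bonds, ∃ q ∈ A, q ≠ p ∧ e ∈ q.bonds) ∧
              IsRConnected (boxSystem (G := G) ρ (![a', a', a', T] : Fin 4 → ℕ)).Adj A ∧ A.card ≤ 4 * (a - 1)),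
          ∑ 𝒞 ∈ (rconnSubsets (boxSystem (G := G) ρ (![a', a', a', T] : Fin 4 → ℕ)).Adj A).powerset with 𝒞.biUnion id = A,
            truncatedWeight (GeomInc (boxSystem (G := G) ρ (![a', a', a', T] : Fin 4 → ℕ)).Adj)
              (connActivity (boxSystem (G := G) ρ (![a', a', a', T] : Fin 4 → ℕ)).Adj (zdHaar 4 G)
                ((boxSystem (G := G) ρ (![a', a', a', T] : Fin 4 → ℕ)).weight z)) 𝒞) / ((a' : ℂ) ^ 3) =
      (∑ A ∈ (Finset.univ : Finset (BoxLabel (![a, a, a, T] : Fin 4 → ℕ))).powerset with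
            ((∀ p ∈ A, ∀ e ∈ p.bonds, ∃ q ∈ A, q ≠ p ∧ e ∈ q.bonds) ∧
              IsRConnected (boxSystem (G := G) ρ (![a, a, a, T] : Fin 4 → ℕ)).Adj A ∧ A.card ≤ 4 * (a - 1)),
          ∑ 𝒞 ∈ (rconnSubsets (boxSystem (G := G) ρ (![a, a, a, T] : Fin 4 → ℕ)).Adj A).powerset with 𝒞.biUnion id = A,
            truncatedWeight (GeomInc (boxSystem (G := G) ρ (![a, a, a, T] : Fin 4 → ℕ)).Adj)
              (connActivity (boxSystem (G := G) ρ (![a, a, a, T] : Fin 4 → ℕ)).Adj (zdHaar 4 G)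
                ((boxSystem (G := G) ρ (![a, a, a, T] : Fin 4 → ℕ)).weight z)) 𝒞) / ((a : ℂ) ^ 3)) :
    ‖tubeLogZ ρ a' T z / ((a' : ℂ) ^ 3) - tubeLogZ ρ a T z / ((a : ℂ) ^ 3)‖ ≤
      12 * T * (‖z‖ / (Real.exp 1 * strongCouplingRadius ρ)) ^ (4 * (a - 1) + 1) := by
  have ha' : 1 < a' := lt_of_lt_of_le ha haa'
  -- the two per-box expansions
  have h1 := norm_tubeLogZ_sub_kept_le ρ hρ ha hT (4 * (a - 1)) hz
  have h2 := norm_tubeLogZ_sub_kept_le ρ hρ ha' hT (4 * (a - 1)) hz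
  set q : ℝ := (‖z‖ / (Real.exp 1 * strongCouplingRadius ρ)) ^ (4 * (a - 1) + 1) with hq
  set Lc : ℂ := Complex.log (∫ h, Complex.exp (-(z * (((N : ℝ) - (ρ h).trace.re : ℝ) : ℂ))) ∂haarProbability G) with hLc
  -- abbreviate the kept sums and the error terms
  set Ka := ∑ A ∈ (Finset.univ : Finset (BoxLabel (![a, a, a, T] : Fin 4 → ℕ))).powerset with
            ((∀ p ∈ A, ∀ e ∈ p.bonds, ∃ q ∈ A, q ≠ p ∧ e ∈ q.bonds) ∧
              IsRConnected (boxSystem (G := G) ρ (![a, a, a, T] : Fin 4 → ℕ)).Adj A ∧ A.card ≤ 4 * (a - 1)),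
          ∑ 𝒞 ∈ (rconnSubsets (boxSystem (G := G) ρ (![a, a, a, T] : Fin 4 → ℕ)).Adj A).powerset with 𝒞.biUnion id = A,
            truncatedWeight (GeomInc (boxSystem (G := G) ρ (![a, a, a, T] : Fin 4 → ℕ)).Adj)
              (connActivity (boxSystem (G := G) ρ (![a, a, a, T] : Fin 4 → ℕ)).Adj (zdHaar 4 G)
                ((boxSystem (G := G) ρ (![a, a, a, T] : Fin 4 → ℕ)).weight z)) 𝒞 with hKa
  set Ka' := ∑ A ∈ (Finset.univ : Finset (BoxLabel (![a', a', a', T] : Fin 4 → ℕ))).powerset with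
            ((∀ p ∈ A, ∀ e ∈ p.bonds, ∃ q ∈ A, q ≠ p ∧ e ∈ q.bonds) ∧
              IsRConnected (boxSystem (G := G) ρ (![a', a', a', T] : Fin 4 → ℕ)).Adj A ∧ A.card ≤ 4 * (a - 1)),
          ∑ 𝒞 ∈ (rconnSubsets (boxSystem (G := G) ρ (![a', a', a', T] : Fin 4 → ℕ)).Adj A).powerset with 𝒞.biUnion id = A,
            truncatedWeight (GeomInc (boxSystem (G := G) ρ (![a', a', a', T] : Fin 4 → ℕ)).Adj)
              (connActivity (boxSystem (G := G) ρ (![a', a', a', T] : Fin 4 → ℕ)).Adj (zdHaar 4 G)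
                ((boxSystem (G := G) ρ (![a', a', a', T] : Fin 4 → ℕ)).weight z)) 𝒞 with hKa'
  set E := tubeLogZ ρ a T z - ((a * a * a * T * 6 : ℕ) : ℂ) * Lc - Ka with hE
  set E' := tubeLogZ ρ a' T z - ((a' * a' * a' * T * 6 : ℕ) : ℂ) * Lc - Ka' with hE'
  have hE1 : ‖E‖ ≤ (a * a * a * T * 6 : ℕ) * q := h1
  have hE2 : ‖E'‖ ≤ (a' * a' * a' * T * 6 : ℕ) * q := h2
  have ha0 : (a : ℂ) ≠ 0 := by exact_mod_cast (show a ≠ 0 by omega)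
  have ha0' : (a' : ℂ) ≠ 0 := by exact_mod_cast (show a' ≠ 0 by omega)
  have ha3 : (a : ℂ) ^ 3 ≠ 0 := pow_ne_zero 3 ha0
  have ha3' : (a' : ℂ) ^ 3 ≠ 0 := pow_ne_zero 3 ha0'
  -- the densities: the singleton parts cancel, the kept parts agree (lifting), the errors remain
  have hdens : tubeLogZ ρ a' T z / ((a' : ℂ) ^ 3) - tubeLogZ ρ a T z / ((a : ℂ) ^ 3) =
      E' / ((a' : ℂ) ^ 3) - E / ((a : ℂ) ^ 3) := by
    have e1 : tubeLogZ ρ a T z = E + ((a * a * a * T * 6 : ℕ) : ℂ) * Lc + Ka := by rw [hE]; ring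
    have e2 : tubeLogZ ρ a' T z = E' + ((a' * a' * a' * T * 6 : ℕ) : ℂ) * Lc + Ka' := by rw [hE']; ring
    rw [e1, e2]
    have hc1 : ((a * a * a * T * 6 : ℕ) : ℂ) * Lc / ((a : ℂ) ^ 3) = 6 * T * Lc := by
      field_simp
      push_cast
      ring
    have hc2 : ((a' * a' * a' * T * 6 : ℕ) : ℂ) * Lc / ((a' : ℂ) ^ 3) = 6 * T * Lc := by
      field_simp
      push_cast
      ring
    rw [add_div, add_div, add_div, add_div, hc1, hc2, hlift]
    ring
  rw [hdens]
  have hn1 : ‖E / ((a : ℂ) ^ 3)‖ ≤ 6 * T * q := by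
    rw [norm_div, norm_pow, Complex.norm_natCast, div_le_iff₀ (by positivity)]
    refine hE1.trans (le_of_eq ?_)
    push_cast
    ring
  have hn2 : ‖E' / ((a' : ℂ) ^ 3)‖ ≤ 6 * T * q := by
    rw [norm_div, norm_pow, Complex.norm_natCast, div_le_iff₀ (by positivity)]
    refine hE2.trans (le_of_eq ?_)
    push_cast
    ring
  calc ‖E' / ((a' : ℂ) ^ 3) - E / ((a : ℂ) ^ 3)‖ ≤ ‖E' / ((a' : ℂ) ^ 3)‖ + ‖E / ((a : ℂ) ^ 3)‖ := norm_sub_le _ _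
    _ ≤ 6 * T * q + 6 * T * q := add_le_add hn2 hn1
    _ = 12 * T * q := by ring

end TwoVolumes

end Summit.QuantumFields.YangMills.Theorems.GlueballBandRecursion.Thermal

end
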